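import Summits.CriticalPhenomena.PercolationContinuityZ3.Theorems.PercNearOneGluingNoHeavyQuantSlabPercOfFiniteSize
import HarnessLib

/-!
# QUANT lane, ERP piece S4b (part 1, the Step III/IV chain): the target property needed only at BOUNDED scales

builds on p205010 (kernel theorem, internal audit signed; external expert review pending)

Cell `prim-quant` (LANE 1, EXPLICIT-RATE PROGRAMME, LADDER R5), seat `prim-quant-p3`; memos `P3-MULTISCALE.md`
§4.2, `P2-EFFECTIVE-KN.md` §1 (hypothesis (a): "hittability of the target geometries from the seed box, BOUNDED
scale range — essential: at `p_c` the unbounded form is false").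

`Quant.ksch_theta_slab_pos_of_finiteSizeAt` (S4a, p207596) takes Kozma–Nitzan's target property (T) for ALL
finite subboxes `D`, hence — through `IsTarget` — for routes of unbounded scale; to DISCHARGE it one needs the
aspect-`2K` geometries to be hit from `Λ(m)` at every scale `ℓ ≥ ℓmax`, which fails at `p_c`.  But the scheme uses
(T) exactly once (`KSch.cond_of_face`, `Literature/Probability/Percolation/KozmaNitzanSteps.lean:699-756`), with
`D = Dpast S e du j ⊆ c + [-25r, 25r]^d` (`c` the centre of the cell `tgt e`).  This file threads that bound through:

* `Quant.route_scale_le_of_Qset_subset` — a route of an aspect-`K'` elongated geometry whose box `v + ℓQ_g` lies in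
  a set contained in `c + [-L, L]^d` has scale `ℓ ≤ L` (two points of `v + ℓQ_g` differ by `ℓ(K'+1) ≥ 2ℓ` in the axis
  coordinate);
* `Quant.dpast_subset_Icc` — `Dpast S e du j ⊆ Icc (c - 25r) (c + 25r)`, `c = S.C.cen (tgt e)`;
* `Quant.cond_of_faceB`, `bad_subset_BevB`, `real_bad_leB`, `fail_boundB` — the tree's Step III/IV chain
  (`KozmaNitzanSteps.lean:699-756, 1601-1613, 1617-1663, 1699-1730`) re-run with the target property hypothesis
  (T_b) demanded only for subboxes `D ⊆ Icc (c - 25r) (c + 25r)` (some `c`);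
* `Quant.ksch_theta_slab_pos_of_boundedTargetAt`, `slabGraph_theta_pos_of_boundedTargetAt`,
  `boundedTargetAt_fails_at_critical` — S4a with (T) replaced by (T_b).  By `route_scale_le_of_Qset_subset` the routes
  of any target in such a `D` have scales `≤ 25r`, so (T_b) follows from the lane's bounded-range additive target
  lemma (`Quant.targetLemma_additive_core`, prim-quant-p2, with `ℓhi = 25r`) and hittability on `[ℓmax, 25r]` only —
  the form available at `p_c` from a crossing hypothesis (S3a).

Honest scope: outer layer of T6-eff with the one unbounded quantifier removed; (C), (Hit), (T_b) are still hypotheses.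
[cite: KozmaNitzan2024, §4 Theorem 6 (pp. 25–31), Step III (p. 30)]
-/

noncomputable section

namespace Summit.CriticalPhenomena.PercolationContinuityZ3.Theorems.Quant

open MeasureTheory ProbabilityTheory Literature.Probability.Percolation Literature.Probability.LatticeModels
open Literature.Probability.Percolation.GadgetSystem Literature.Probability.Percolation.ProbeHistory
open Literature.Probability.Percolation.KozmaNitzan Literature.Probability.Percolation.KozmaNitzan.KSch
open Literature.Probability.Percolation.KozmaNitzan.Cells
open scoped Classical

variable {d : ℕ}

/-! ## Routes inside a bounded box have bounded scale -/

/-- **A route inside a bounded region has bounded scale.**  If `g` is one of the aspect-`K'` elongated geometries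
(`g ∈ elongList d K' hK'`, `K' ≥ 1`) and its box `v + ℓQ_g` lies in a set `D ⊆ Icc (c - L) (c + L)`, then `ℓ ≤ L`:
the points `v - σℓ e_a` and `v + σℓK' e_a` of `v + ℓQ_g = sBox a σ v (-ℓ) (ℓK') ℓ` differ by `ℓ(K'+1) ≥ 2ℓ` in the
coordinate `a`, and both lie in `c + [-L, L]^d`. [folklore] -/
theorem route_scale_le_of_Qset_subset {K' : ℕ} (hK' : 1 ≤ K') {g : Geom d} (hg : g ∈ elongList d K' hK')
    {ℓ : ℕ} {v c : Site d} {L : ℕ} {D : Finset (Site d)} (hQ : g.Qset ℓ v ⊆ D)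
    (hD : D ⊆ Finset.Icc (c - ((L : ℕ) : Site d)) (c + ((L : ℕ) : Site d))) : ℓ ≤ L := by
  obtain ⟨x, -, rfl⟩ := List.mem_map.1 hg
  obtain ⟨a, σ⟩ := x
  rw [elongGeom_Qset_eq] at hQ
  have hσ := units_sign σ
  -- the two extreme points of the box along the axis `a`
  set x₁ : Site d := Function.update v a (v a - (σ : ℤ) * ℓ) with hx₁
  set x₂ : Site d := Function.update v a (v a + (σ : ℤ) * (ℓ * K')) with hx₂
  have hσsq : (σ : ℤ) * (σ : ℤ) = 1 := by rcases hσ with h | h <;> rw [h] <;> norm_num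
  have hℓ0 : (0 : ℤ) ≤ ℓ := by positivity
  have hx₁mem : x₁ ∈ sBox a (σ : ℤ) v (-(ℓ : ℤ)) (ℓ * K') ℓ := by
    rw [mem_sBox_iff hσ]
    refine ⟨?_, fun j hj => ?_⟩
    · have : (σ : ℤ) * (x₁ a - v a) = -(ℓ : ℤ) := by
        simp only [hx₁, Function.update_self]; linear_combination (-(ℓ : ℤ)) * hσsq
      rw [this]; constructor
      · exact le_rfl
      · have : (0 : ℤ) ≤ (ℓ : ℤ) * K' := by positivity
        linarith
    · simp only [hx₁, Function.update_of_ne hj]; constructor <;> linarith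
  have hx₂mem : x₂ ∈ sBox a (σ : ℤ) v (-(ℓ : ℤ)) (ℓ * K') ℓ := by
    rw [mem_sBox_iff hσ]
    refine ⟨?_, fun j hj => ?_⟩
    · have : (σ : ℤ) * (x₂ a - v a) = (ℓ : ℤ) * K' := by
        simp only [hx₂, Function.update_self]; linear_combination ((ℓ : ℤ) * K') * hσsq
      rw [this]; constructor
      · have : (0 : ℤ) ≤ (ℓ : ℤ) * K' := by positivity
        linarith
      · exact le_rfl
    · simp only [hx₂, Function.update_of_ne hj]; constructor <;> linarith
  have h₁ := Finset.mem_Icc.1 (hD (hQ hx₁mem))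
  have h₂ := Finset.mem_Icc.1 (hD (hQ hx₂mem))
  have h₁a : (c - ((L : ℕ) : Site d)) a ≤ x₁ a ∧ x₁ a ≤ (c + ((L : ℕ) : Site d)) a := ⟨h₁.1 a, h₁.2 a⟩
  have h₂a : (c - ((L : ℕ) : Site d)) a ≤ x₂ a ∧ x₂ a ≤ (c + ((L : ℕ) : Site d)) a := ⟨h₂.1 a, h₂.2 a⟩
  simp only [Pi.sub_apply, Pi.add_apply, Pi.natCast_apply, hx₁, hx₂, Function.update_self] at h₁a h₂a
  have hK'1 : (1 : ℤ) ≤ K' := by exact_mod_cast hK'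
  have key : (ℓ : ℤ) * (K' + 1) ≤ 2 * L := by
    rcases hσ with h | h <;> rw [h] at h₁a h₂a <;> nlinarith [h₁a.1, h₁a.2, h₂a.1, h₂a.2]
  have : (2 : ℤ) * ℓ ≤ 2 * L := by nlinarith
  exact_mod_cast (show (ℓ : ℤ) ≤ L by linarith)

/-- **The Step-III subbox is bounded**: `Dpast S e du j ⊆ Icc (c - 25r) (c + 25r)` with `c = S.C.cen (tgt e)` (levels in
`(5r + 10sj, 25r]`, width `5r`). [cite: KozmaNitzan2024, §4 p. 30 (D = E_{v,x} \ E^j_{v,x})] -/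
theorem dpast_subset_Icc (S : KSch d) (e : Site 2 × MDir) (du : MDir) (j : ℕ) :
    Dpast S e du j ⊆ Finset.Icc (S.C.cen (tgt e) - (((25 * S.C.r : ℕ) : ℕ) : Site d))
      (S.C.cen (tgt e) + (((25 * S.C.r : ℕ) : ℕ) : Site d)) := by
  intro y hy
  rw [Dpast, mem_sBox_iff (sgOf_sign du)] at hy
  obtain ⟨⟨h1, h2⟩, ht⟩ := hy
  have hr0 : (0 : ℤ) ≤ S.C.r := by positivity
  have hs0 : (0 : ℤ) ≤ S.C.s := by positivity
  rw [Finset.mem_Icc]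
  constructor
  · intro i
    simp only [Pi.sub_apply, Pi.natCast_apply]
    by_cases hi : i = S.C.axOf du
    · subst hi
      push_cast
      rcases sgOf_sign du with h | h <;> rw [h] at h1 h2 <;> nlinarith
    · have := ht i hi
      push_cast; linarith [this.1]
  · intro i
    simp only [Pi.add_apply, Pi.natCast_apply]
    by_cases hi : i = S.C.axOf du
    · subst hi
      push_cast
      rcases sgOf_sign du with h | h <;> rw [h] at h1 h2 <;> nlinarith
    · have := ht i hi
      push_cast; linarith [this.2]

/-! ## Step III/IV with the bounded target property -/

section Setting

variable {S : KSch d} {h : ProbeHistory (Site d)} {e : Site 2 × MDir} (hV : S.Valid h e) {du : MDir}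
  (hdu : du ∈ S.onward h (tgt e))
include hV hdu

/-- **(T_b) ⇒ goodness at level `j`** (the tree's `KSch.cond_of_face` with the target property hypothesis demanded only
for subboxes `D ⊆ Icc (c - 25r) (c + 25r)`): if `F^{j+1}_{v,x}` is reached from `0` with probability `> 1 - δ₂` under
the weighting of level `j`, the connection is good at level `j`.  Verbatim from the tree, plus `dpast_subset_Icc`.
[cite: KozmaNitzan2024, §4 p. 30 (Step III)] -/
theorem cond_of_faceB {δ₂ : ℝ} {R : ℕ}
    (htgt : ∀ (W : Sym2 (Site d) → unitInterval) (Sfin D : Finset (Site d)) (lo hi : Site d)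
      (T : Finset (Site d)) (o c : Site d),
      FinSupp W Sfin → IsSubbox W S.p D → D ⊆ Sfin → o ∈ Sfin → o ∉ D →
      Finset.Icc (lo - (R : Site d)) (hi + (R : Site d)) ⊆ D →
      D ⊆ Finset.Icc (c - (((25 * S.C.r : ℕ) : ℕ) : Site d)) (c + (((25 * S.C.r : ℕ) : ℕ) : Site d)) →
      IsTarget T lo hi D R (elongList d (2 * S.C.K) (by have := S.C.hK; omega)) → T ⊆ D → T.Nonempty →
      1 - δ₂ < (prodBernoulli W).real (⋃ b ∈ Finset.Icc lo hi, openConn o b) →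
      1 - S.δc < (prodBernoulli W).real (⋃ t ∈ T, openConn o t))
    (hRs : 2 * R ≤ S.C.s) {j : ℕ} (hj : j < S.C.K) (o : Finset (Sym2 (Site d)))
    (hface : 1 - δ₂ < (prodBernoulli (S.Wt h e du j o)).real
      (⋃ b ∈ S.C.Face (tgt e) du (j + 1), openConn (0 : Site d) b)) :
    S.cond h e du j o := by
  set D := Dpast S e du j with hD
  have hK : (20 : ℤ) ≤ S.C.K := by exact_mod_cast S.C.hK
  have hs1 : (1 : ℤ) ≤ S.C.s := by exact_mod_cast S.C.hs
  have hr1 : (1 : ℤ) ≤ S.C.r := by exact_mod_cast S.C.r_pos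
  have hrK : (S.C.r : ℤ) = S.C.K * S.C.s := by unfold Cells.r; push_cast; ring
  have hRs' : 2 * (R : ℤ) ≤ S.C.s := by exact_mod_cast hRs
  have hjK : (j : ℤ) + 1 ≤ S.C.K := by exact_mod_cast hj
  have hjs : 10 * (S.C.s : ℤ) * (j + 1) ≤ 10 * S.C.s * S.C.K := mul_le_mul_of_nonneg_left hjK (by positivity)
  have hKs20 : 20 * (S.C.s : ℤ) ≤ S.C.K * S.C.s := mul_le_mul_of_nonneg_right hK (by linarith)
  have hj0 : (0 : ℤ) ≤ 10 * S.C.s * j := by positivity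
  have hDE : D ⊆ S.C.Efar (tgt e) du := Dpast_subset_Efar j
  have hDS : D ⊆ S.Sx h e du := hDE.trans Finset.subset_union_right
  -- the subbox
  have hsub : IsSubbox (S.Wt h e du j o) S.p D := by
    refine ((isSubbox_lattW S.p D).pinW _ fun x hx y hy hyD => ?_).restrW (Finset.coe_subset.2 hDS)
    have hx' : x ∈ S.Fj h e du j := hx
    rw [Fj, mem_edgesIn_iff] at hx'
    rcases Finset.mem_union.1 (hx'.2 y hy) with hy' | hy'
    · rcases Finset.mem_union.1 hy' with hy'' | hy''
      · exact (Valid.sep_Efar hV hdu).not_mem (Finset.mem_coe.2 hy'') (Finset.mem_coe.2 (hDE hyD))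
      · exact Valid.Ewv_not_mem_Efar hV hdu hy'' (hDE hyD)
    · rw [Cells.Stub, mem_sBox_iff (sgOf_sign du)] at hy'
      rw [hD, Dpast, mem_sBox_iff (sgOf_sign du)] at hyD
      linarith [hy'.1.2, hyD.1.1]
  have h0S : (0 : Site d) ∈ S.Sx h e du := Finset.mem_union_left _ (Finset.mem_union_left _ hV.zero_mem)
  have h0D : (0 : Site d) ∉ D := fun h0 =>
    (Valid.sep_Efar hV hdu).not_mem (Finset.mem_coe.2 hV.zero_mem) (Finset.mem_coe.2 (hDE h0))
  -- the enlarged face lies in `D`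
  have hencl : Finset.Icc (sLo (S.C.axOf du) (sgOf du) (S.C.cen (tgt e)) (5 * S.C.r + 10 * S.C.s * (j + 1 : ℕ))
        (5 * S.C.r + 10 * S.C.s * (j + 1 : ℕ)) (2 * S.C.r) - (R : Site d))
      (sHi (S.C.axOf du) (sgOf du) (S.C.cen (tgt e)) (5 * S.C.r + 10 * S.C.s * (j + 1 : ℕ))
        (5 * S.C.r + 10 * S.C.s * (j + 1 : ℕ)) (2 * S.C.r) + (R : Site d)) ⊆ D := by
    rw [sBox_enlarge _ _ (sgOf_sign du)]
    refine sBox_mono (sgOf_sign du) _ ?_ ?_ ?_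
    · push_cast; linarith
    · push_cast; nlinarith
    · linarith
  -- `M_x ⊆ D`
  have hMD : S.C.M (tgt e + stepVec du) ⊆ D := by
    intro y hy
    obtain ⟨hl, ht⟩ := S.C.level_of_mem_M_tgt hy
    rw [hD, Dpast, mem_sBox_iff (sgOf_sign du)]
    refine ⟨⟨by nlinarith [hl.1], by linarith [hl.2]⟩, fun i hi => ?_⟩
    have := ht i hi; constructor <;> linarith [this.1, this.2]
  have hMne : (S.C.M (tgt e + stepVec du)).Nonempty := ⟨_, center_mem_cIcc _ _⟩
  exact htgt (S.Wt h e du j o) (S.Sx h e du) D _ _ (S.C.M (tgt e + stepVec du)) 0 (S.C.cen (tgt e))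
    (finSupp_restrW _ _) hsub hDS h0S h0D hencl (dpast_subset_Icc S e du j) (isTarget_stepIII hRs hj) hMD hMne hface

/-- **Step III inside Step IV, bounded form**: a bad direction lies in every `B_j`. [cite: KozmaNitzan2024, §4 p. 30 (Step III)] -/
theorem bad_subset_BevB {δ₂ : ℝ} {R : ℕ}
    (htgt : ∀ (W : Sym2 (Site d) → unitInterval) (Sfin D : Finset (Site d)) (lo hi : Site d)
      (T : Finset (Site d)) (o c : Site d),
      FinSupp W Sfin → IsSubbox W S.p D → D ⊆ Sfin → o ∈ Sfin → o ∉ D →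
      Finset.Icc (lo - (R : Site d)) (hi + (R : Site d)) ⊆ D →
      D ⊆ Finset.Icc (c - (((25 * S.C.r : ℕ) : ℕ) : Site d)) (c + (((25 * S.C.r : ℕ) : ℕ) : Site d)) →
      IsTarget T lo hi D R (elongList d (2 * S.C.K) (by have := S.C.hK; omega)) → T ⊆ D → T.Nonempty →
      1 - δ₂ < (prodBernoulli W).real (⋃ b ∈ Finset.Icc lo hi, openConn o b) →
      1 - S.δc < (prodBernoulli W).real (⋃ t ∈ T, openConn o t))
    (hRs : 2 * R ≤ S.C.s) {j : ℕ} (hj : j < S.C.K) : S.bad h e du ⊆ S.Bev h e du j δ₂ := by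
  intro ω hω
  by_contra hB
  simp only [Bev, Set.mem_setOf_eq, not_le] at hB
  exact hω j hj (cond_of_faceB hV hdu htgt hRs hj _ hB)

/-- **(36)–(37) for one direction, bounded form**: `μ(bad) ≤ (1 - δ₂)^K + ε'`, given Lemma 12 (`hcorr`, at `ε'`) and the
bounded target property (`htgt`). [cite: KozmaNitzan2024, §4 p. 31 ((36), (37))] -/
theorem real_bad_leB {ε' δ₂ : ℝ} (hδ₂ : δ₂ ≤ 1) {R : ℕ}
    (hcorr : ∀ T : CData d, T.Hyp S.p → T.r = S.C.r →
      1 - S.δc < (prodBernoulli T.W).real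
          (⋃ b ∈ Finset.Icc (T.c - ((3 * T.r : ℕ) : Site d)) (T.c + ((3 * T.r : ℕ) : Site d)),
            openConnIn (↑T.Aset : Set (Site d)) T.o b) →
        1 - ε' < (prodBernoulli T.W).real (⋃ b ∈ T.Tn (3 * T.r), openConnIn (↑T.Uset : Set (Site d)) T.o b))
    (htgt : ∀ (W : Sym2 (Site d) → unitInterval) (Sfin D : Finset (Site d)) (lo hi : Site d)
      (T : Finset (Site d)) (o c : Site d),
      FinSupp W Sfin → IsSubbox W S.p D → D ⊆ Sfin → o ∈ Sfin → o ∉ D →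
      Finset.Icc (lo - (R : Site d)) (hi + (R : Site d)) ⊆ D →
      D ⊆ Finset.Icc (c - (((25 * S.C.r : ℕ) : ℕ) : Site d)) (c + (((25 * S.C.r : ℕ) : ℕ) : Site d)) →
      IsTarget T lo hi D R (elongList d (2 * S.C.K) (by have := S.C.hK; omega)) → T ⊆ D → T.Nonempty →
      1 - δ₂ < (prodBernoulli W).real (⋃ b ∈ Finset.Icc lo hi, openConn o b) →
      1 - S.δc < (prodBernoulli W).real (⋃ t ∈ T, openConn o t))
    (hRs : 2 * R ≤ S.C.s) :
    (prodBernoulli (S.Wfull h e du)).real (S.bad h e du) ≤ (1 - δ₂) ^ S.C.K + ε' := by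
  set μ := prodBernoulli (S.Wfull h e du) with hμ
  set Cyl := localCylinder (↑(S.F h) : Set (Sym2 (Site d))) (↑(S.ξ h) : Set (Sym2 (Site d))) with hCyl
  set L := lattOnly (S.V h ∪ S.C.Ewv e.1 e.2 ∪ S.C.Hfull (tgt e) du) with hL
  have hreach : 1 - ε' < μ.real (S.Reach h e du) := reach_bound hV hdu hcorr
  have hRm : MeasurableSet (S.Reach h e du) := measurableSet_biUnion_openConnIn _ _ _
  have hae : ∀ᵐ ω ∂μ, ω ∈ Cyl ∩ L := by
    filter_upwards [Valid.ae_cyl hV (du := du),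
      Valid.ae_lattOnly hV (du := du) (S.V h ∪ S.C.Ewv e.1 e.2 ∪ S.C.Hfull (tgt e) du)] with ω h1 h2
    exact ⟨h1, h2⟩
  have hnull : μ.real (Cyl ∩ L)ᶜ = 0 := by
    have : μ (Cyl ∩ L)ᶜ = 0 := mem_ae_iff.1 hae
    exact (measureReal_eq_zero_iff (measure_ne_top _ _)).2 this
  have h1 : μ.real (S.bad h e du) ≤ μ.real (S.bad h e du ∩ (Cyl ∩ L)) + μ.real (Cyl ∩ L)ᶜ := by
    refine le_trans (measureReal_mono ?_ (measure_ne_top _ _)) (measureReal_union_le _ _)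
    intro ω hω
    by_cases h' : ω ∈ Cyl ∩ L
    · exact Or.inl ⟨hω, h'⟩
    · exact Or.inr h'
  have h2 : S.bad h e du ∩ (Cyl ∩ L) ⊆ (S.Gev h e du δ₂ S.C.K ∩ Cyl) ∪ (S.Reach h e du)ᶜ := by
    rintro ω ⟨hω, hC, hωL⟩
    by_cases hR : ω ∈ S.Reach h e du
    · refine Or.inl ⟨mem_Gev_of_forall (fun j hj => bad_subset_BevB hV hdu htgt hRs hj hω)
        (fun j hj => mem_Aface_of_reach hV hdu hωL hR hj) _ le_rfl, hC⟩
    · exact Or.inr hR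
  have h3 : μ.real (S.Reach h e du)ᶜ < ε' := by
    rw [probReal_compl_eq_one_sub hRm]; linarith
  calc μ.real (S.bad h e du) ≤ μ.real (S.bad h e du ∩ (Cyl ∩ L)) + μ.real (Cyl ∩ L)ᶜ := h1
    _ ≤ μ.real ((S.Gev h e du δ₂ S.C.K ∩ Cyl) ∪ (S.Reach h e du)ᶜ) + 0 := by
        rw [hnull]; exact add_le_add (measureReal_mono h2 (measure_ne_top _ _)) le_rfl
    _ ≤ μ.real (S.Gev h e du δ₂ S.C.K ∩ Cyl) + μ.real (S.Reach h e du)ᶜ := by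
        rw [add_zero]; exact measureReal_union_le _ _
    _ ≤ (1 - δ₂) ^ S.C.K + ε' := add_le_add (real_Gev_le hV hdu hδ₂ _ le_rfl) h3.le

omit hdu in
/-- **(33), bounded form: the examination fails with probability at most `ε`** — after a valid history, given Lemma 12 at
`ε/8` (`hcorr`), the bounded target property with `δ₂ ≤ 1` and `2R ≤ s` (`htgt`), and `(1 - δ₂)^K + ε/8 ≤ ε/4`.
[cite: KozmaNitzan2024, §4 pp. 28–31 ((33), Steps I–IV)] -/
theorem fail_boundB {ε δ₂ : ℝ} (hε : 0 ≤ ε) (hδ₂ : δ₂ ≤ 1) {R : ℕ}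
    (hcorr : ∀ T : CData d, T.Hyp S.p → T.r = S.C.r →
      1 - S.δc < (prodBernoulli T.W).real
          (⋃ b ∈ Finset.Icc (T.c - ((3 * T.r : ℕ) : Site d)) (T.c + ((3 * T.r : ℕ) : Site d)),
            openConnIn (↑T.Aset : Set (Site d)) T.o b) →
        1 - ε / 8 < (prodBernoulli T.W).real (⋃ b ∈ T.Tn (3 * T.r), openConnIn (↑T.Uset : Set (Site d)) T.o b))
    (htgt : ∀ (W : Sym2 (Site d) → unitInterval) (Sfin D : Finset (Site d)) (lo hi : Site d)
      (T : Finset (Site d)) (o c : Site d),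
      FinSupp W Sfin → IsSubbox W S.p D → D ⊆ Sfin → o ∈ Sfin → o ∉ D →
      Finset.Icc (lo - (R : Site d)) (hi + (R : Site d)) ⊆ D →
      D ⊆ Finset.Icc (c - (((25 * S.C.r : ℕ) : ℕ) : Site d)) (c + (((25 * S.C.r : ℕ) : ℕ) : Site d)) →
      IsTarget T lo hi D R (elongList d (2 * S.C.K) (by have := S.C.hK; omega)) → T ⊆ D → T.Nonempty →
      1 - δ₂ < (prodBernoulli W).real (⋃ b ∈ Finset.Icc lo hi, openConn o b) →
      1 - S.δc < (prodBernoulli W).real (⋃ t ∈ T, openConn o t))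
    (hRs : 2 * R ≤ S.C.s) (hKε : (1 - δ₂) ^ S.C.K + ε / 8 ≤ ε / 4) :
    (bondPercolation (zdGraph d) S.p).real {ω | ¬S.succ h e ((S.probe h e).read ω)} ≤ ε := by
  have hcard : ((S.onward h (tgt e)).card : ℝ) ≤ 4 := by
    have h1 : (S.onward h (tgt e)).card ≤ Fintype.card MDir := Finset.card_le_univ _
    have h2 : Fintype.card MDir = 4 := by simp [MDir, Fintype.card_prod, Fintype.card_bool, Fintype.card_fin]
    have h3 : (S.onward h (tgt e)).card ≤ 4 := h2 ▸ h1
    exact_mod_cast h3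
  calc (bondPercolation (zdGraph d) S.p).real {ω | ¬S.succ h e ((S.probe h e).read ω)}
      ≤ (bondPercolation (zdGraph d) S.p).real (⋃ du ∈ S.onward h (tgt e), S.bad h e du) :=
        measureReal_mono (not_succ_subset S h e) (measure_ne_top _ _)
    _ ≤ ∑ du ∈ S.onward h (tgt e), (bondPercolation (zdGraph d) S.p).real (S.bad h e du) :=
        measureReal_biUnion_finset_le _ _
    _ ≤ ∑ du ∈ S.onward h (tgt e), ε / 4 := by
        refine Finset.sum_le_sum fun du hdu' => ?_
        rw [real_bad_eq]
        exact (real_bad_leB hV hdu' hδ₂ hcorr htgt hRs).trans hKε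
    _ = (S.onward h (tgt e)).card * (ε / 4) := by rw [Finset.sum_const, nsmul_eq_mul]
    _ ≤ 4 * (ε / 4) := mul_le_mul_of_nonneg_right hcard (by linarith)
    _ = ε := by ring

end Setting

end Summit.CriticalPhenomena.PercolationContinuityZ3.Theorems.Quant

end
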